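import Literature.IUT.HodgeArakelov.ThetaMonoidsMultiradialTransport
import Literature.IUT.HodgeArakelov.CohomologyAutFunctorialityLaws
import Literature.IUT.HodgeArakelov.CohomologyAutConjCompat
import Literature.IUT.HodgeArakelov.MonoThetaProjectiveThetaEnvRecordInversions
import Literature.IUT.HodgeArakelov.EtaleThetaDataOfSettingInversion
import Literature.IUT.HodgeArakelov.MonoThetaCyclotomesBridgeEtTh

/-!
# [IUTchII] Prop 3.4 (i) at the GENUINE data: the `Aut(Π^tp_{X̲̲_k})`-action on the Prop 3.1 record (junction J10,
# genuine form) and the multiradiality of `Π_v ↦ (Π_v ↷ Ψ_env(M^Θ_*(Π_v)))` on the genuine functor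

S. Mochizuki, *Inter-universal Teichmüller theory II*, §3, Prop 3.4 (i), kurims pp. 91–92 [cite: Mochizuki2012,
Prop 3.4 (i) p.91]: "Each isomorphism of projective systems of mono-theta environments … induces compatible
collections of isomorphisms …; the left-hand square in each diagram arises from the functoriality of the algorithms
involved …; the functorial algorithms `Π_v ↦ Ψ_env(M^Θ_*(Π_v))`; `Π_v ↦ ∞Ψ_env(M^Θ_*(Π_v))` … are compatible … in the
sense that the natural functor `Ψ_ℛ` of Corollary 1.12, (iii), is multiradially defined."  Claim key DISPUTED
(D-0012); this file CONSTRUCTS and PROVES over the cell's own objects (continuous group cohomology, its direct limit,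
the transport of structure along automorphism pairs); nothing of [IUTchII] is asserted; no side taken on [IUTchIII]
Cor 3.12.  abc-iut cell, layer L6, seat abc-iut-w5-d169 (W6-S6 holder), `plan/L6/SUBDAG-IUTchII-Prop-31-33-34.md`
junction **J10 (genuine)** = the input `ThetaEnvData.AutIsoAction` of `ThetaMonoidsMultiradialTransport.lean` (p419843)
AT the genuine record of abc-iut-w4-d019/abc-iut-w4-d030 (`ThetaEnvData.toRecord` over abc-iut-w4-d030's `θ_env`
data `EtaleLevels.thetaEnvData` of the natural system of `X̲̲_K`).

WHAT IS BUILT (everything consumed BY NAME; the mathematical inputs are explicit BINDERS, no `Prop` is defined):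
* `EtaleLevels.inversionOrbit ρ` — the `Π^tp_{X̲̲}`-conjugacy ORBIT `{conj_h ∘ ρ ∘ conj_h⁻¹}` of an inversion action `ρ`
  on `lim_J H¹(Π^tp_{Ÿ̲̲} ∩ J, l·Δ_Θ)` (abc-iut-w4-d030 part 5f's family, as a SET: "`ι` ranges over the inversion
  automorphisms", Prop 3.1 (i) p. 87; Prop 2.2 (i) "conjugates of inversion automorphisms are inversion
  automorphisms"), and the record `thetaEnvRecordOrbit κ ρ` indexed by it; J2 (`ThetaEnvPermuted`) for it.
* `EtaleLevels.AutCompanion C` — INPUT (P1) (DATA): a homomorphic choice `α ↦ β(α)` of companions on `(Π^tp_X)^Θ`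
  for the topological automorphisms of `Π^tp_{X̲̲}` ([EtTh] Cor 2.18 (i) class: characteristic subquotients; the
  stabilisation of `Π^tp_{Ÿ̲̲}` is abc-iut-L6-t1's `PiYddCharacteristic`, already a binder of the genuine data);
  `pairAct B α :=` abc-iut-w5-d072's `pairRhoLim` (= abc-iut-L6-t1's `h1LimAutEquiv`), a HOMOMORPHISM in `α`
  (`pairAct_refl/_trans/_symm`, by `CohomologyAutFunctorialityLaws`).
* `EtaleLevels.autIsoActionOrbit` — the `AutIsoAction` on `thetaEnvRecordOrbit κ ρ`, from (P1) and the binders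
  (P2) `hρ`: each `ρ_(α,β(α)) ∘ ρ ∘ ρ_(α,β(α))⁻¹` is a `Π`-conjugate of `ρ` (so the pair action permutes the orbit by
  CONJUGATION — functorial for free, `CohomologyAutConjCompat`); (P3) `hκ`: the Kummer image `κ(𝒪^▷)` is
  `ρ_(α,β)`-stable ([AbsTopIII] §3; abc-iut-w4-d043's `CohomologyAutKummer` is the case `α` over `G_k`);
  (P4) `hθ`, `hinf`: `ρ_(α,β)` stabilises `toLim '' θ(Π)` and `∞θ(Π)` ([EtTh] constant-multiple rigidity class; the
  inner case is abc-iut-w4-d030's p418231).  `map_conj` = `h1LimAut_h1LimConj`; functor laws = the pair-action laws.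
* `EtaleLevels.prop34i_multiradiallyDefined_genuine` — J12 AT THE GENUINE FUNCTOR: `prop34i_multiradiallyDefined`
  for `ThetaEnvTransport.ofAutAction (thetaEnvRecordOrbit κ ρ) (autIsoActionOrbit …)` over abc-iut-L6-d6's
  `ThetaSetting.ofDoubleUnderline` (whose `Π^tp_{X̲̲_k}` IS `Pi C`).
HONEST RESIDUAL of [IUTchII] Prop 3.4 (i) multiradiality at the genuine data after this file = exactly the binders
(P1)–(P4), each a published-prerequisite-class input with its owner named above.
-/

noncomputable section

namespace Literature.IUT.HodgeArakelov

open Literature.AnabelianGeometry.EtaleTheta Literature.AnabelianGeometry.SemiGraphs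
open CohomologySystemOfContH1 EtaleThetaDataOfSetting TemperedThetaMonoids
open scoped Literature.AnabelianGeometry.EtaleTheta

/-! ### 0. Generic: unit groups of stable submonoids are stable -/

/-- If a multiplicative automorphism carries a submonoid onto itself, it carries its unit group (abc-iut-w4-d019's
`unitsOfSubmonoid`) onto itself (local helper). [folklore] -/
private theorem unitsOfSubmonoid_map_eq {H : Type} [CommGroup H] (S : Submonoid H) (e : H ≃* H)
    (h : S.map (e : H →* H) = S) : (unitsOfSubmonoid S).map (e : H →* H) = unitsOfSubmonoid S := by
  have hmem : ∀ x, x ∈ S → e x ∈ S := fun x hx => by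
    rw [← h]; exact ⟨x, hx, rfl⟩
  have hmem' : ∀ y, y ∈ S → e.symm y ∈ S := fun y hy => by
    rw [← h] at hy
    obtain ⟨x, hx, hxy⟩ := hy
    have : e.symm y = x := by rw [← hxy]; exact e.symm_apply_apply x
    rw [this]; exact hx
  ext y
  constructor
  · rintro ⟨x, ⟨hx, hx'⟩, rfl⟩
    exact ⟨hmem x hx, by rw [MonoidHom.coe_coe, ← map_inv]; exact hmem _ hx'⟩
  · rintro ⟨hy, hy'⟩
    refine ⟨e.symm y, ⟨hmem' y hy, ?_⟩, by simp⟩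
    rw [← map_inv]; exact hmem' _ hy'

namespace EtaleLevels

variable {p : ℕ} [Fact p.Prime] {D : Literature.AnabelianGeometry.EtaleTheta.ThetaSetting p}
  {E : D.EtaleThetaData} {l : ℕ} (C : E.DoubleUnderline l) (hC : D.Compat) (hS : D.Sec2Hyps)
  (hl : l.Prime) (hp2 : p ≠ 2) (hpl : p ≠ l) (hζ : ∃ ζ : D.K, IsPrimitiveRoot ζ (4 * l))
  (mods : ∀ M : ℕ+, D.CyclotomeMod l M)
  (f : contCocycles D.toTheta D.DeltaTheta C.GtpYdduu) (hf : f ∈ C.rootCocycles hC)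
  (hmods : ∀ (M M' : ℕ+) (h : (M : ℕ) ∣ (M' : ℕ)) (x : D.lDeltaTheta l),
    MuN.red p M M' h ((mods M').red x) = (mods M).red x)
  (h15 : Literature.AnabelianGeometry.EtaleTheta.ThetaSetting.Prop15iii E hC) (L : C.CuspLabels)
  (hZ : ∀ M : ℕ+, Nonempty (ModelCyclotomes.lDeltaQuot (C.rigidData (mods M) hC hS h15 L) ≃*
    Literature.IUT.HodgeTheaters.ZHat))
  (hcharY : EtaleThetaDataOfSetting.PiYddCharacteristic C)
  (hlim : Function.Bijective (rigidLimHom C hC hS hl hp2 hpl hζ mods f hf hmods h15 L hZ))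
  [(EtaleThetaDataOfSetting.PiYdd C).Normal]

/-! ### 1. The conjugacy orbit of an inversion action and the record indexed by it -/

/-- **The family of inversion automorphisms as a SET**: the `Π^tp_{X̲̲}`-conjugacy orbit
`{conj_h ∘ ρ ∘ conj_h⁻¹ | h ∈ Π^tp_{X̲̲}}` of an inversion action `ρ` on `lim_J H¹(Π^tp_{Ÿ̲̲} ∩ J, l·Δ_Θ)` ("`ι` ranges
over the inversion automorphisms of Proposition 2.2, (i)", Prop 3.1 (i) p. 87; Rmk 1.4.1 (ii)).
[cite: Mochizuki2012, Prop 3.1 (i) p.87] -/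
def inversionOrbit (ρ : h1Lim (phi C) (D.lDeltaTheta l) (PiYdd C) ⊥ ≃+ h1Lim (phi C) (D.lDeltaTheta l) (PiYdd C) ⊥) : Set (h1Lim (phi C) (D.lDeltaTheta l) (PiYdd C) ⊥ ≃+ h1Lim (phi C) (D.lDeltaTheta l) (PiYdd C) ⊥) :=
  {e | ∃ h : Pi C, ∀ x, e x = h1LimConj (phi C) (D.lDeltaTheta l) (PiYdd C) h (ρ (h1LimConj (phi C) (D.lDeltaTheta l) (PiYdd C) h⁻¹ x))}

/-- `ρ` itself lies in its orbit. [cite: Mochizuki2012, Prop 3.1 (i) p.87] -/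
theorem self_mem_inversionOrbit (ρ : h1Lim (phi C) (D.lDeltaTheta l) (PiYdd C) ⊥ ≃+ h1Lim (phi C) (D.lDeltaTheta l) (PiYdd C) ⊥) : ρ ∈ inversionOrbit C ρ :=
  ⟨1, fun x => by rw [inv_one, h1LimConj_one_apply, h1LimConj_one_apply]⟩

/-- The orbit is stable under conjugation by `Π^tp_{X̲̲}` ("conjugates of inversion automorphisms are inversion
automorphisms", Prop 2.2 (i)). [cite: Mochizuki2012, Prop 2.2 (i) p.66] -/
theorem conj_mem_inversionOrbit (ρ : h1Lim (phi C) (D.lDeltaTheta l) (PiYdd C) ⊥ ≃+ h1Lim (phi C) (D.lDeltaTheta l) (PiYdd C) ⊥) (g : Pi C) {e : h1Lim (phi C) (D.lDeltaTheta l) (PiYdd C) ⊥ ≃+ h1Lim (phi C) (D.lDeltaTheta l) (PiYdd C) ⊥}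
    (he : e ∈ inversionOrbit C ρ) :
    ((h1LimConjEquiv (phi C) (D.lDeltaTheta l) (PiYdd C) g⁻¹).trans
      (e.trans (h1LimConjEquiv (phi C) (D.lDeltaTheta l) (PiYdd C) g))) ∈ inversionOrbit C ρ := by
  obtain ⟨h, hh⟩ := he
  refine ⟨g * h, fun x => ?_⟩
  rw [AddEquiv.trans_apply, AddEquiv.trans_apply, h1LimConjEquiv_apply, hh, h1LimConjEquiv_apply,
    ← h1LimConj_mul_apply, ← h1LimConj_mul_apply, mul_inv_rev]

/-- **The [IUTchII] Prop 3.1 input record of the natural system of `X̲̲_K` with `ι` ranging over the conjugacy ORBIT of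
an inversion action** (abc-iut-w4-d019's `toRecord` over abc-iut-w4-d030's genuine `θ_env` data; conjugation action
of `Π^tp_{X̲̲}` = abc-iut-w4-d007's `h1LimConjMulAut`; `κ` the Kummer map of the constant monoid).
[cite: Mochizuki2012, Prop 3.1 (i) p.87] -/
def thetaEnvRecordOrbit {M : Type} [CommMonoid M]
    (κ : M →* Multiplicative (thetaEnvData C hC hS hl hp2 hpl hζ mods f hf hmods h15 L hZ hcharY hlim).cohEnv.lim)
    (ρ : h1Lim (phi C) (D.lDeltaTheta l) (PiYdd C) ⊥ ≃+ h1Lim (phi C) (D.lDeltaTheta l) (PiYdd C) ⊥) :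
    TemperedThetaMonoids.ThetaEnvData.{0, 0} (modelSystem C hC hS hl hp2 hpl hζ mods f hf hmods h15 L hZ).PiX :=
  (thetaEnvData C hC hS hl hp2 hpl hζ mods f hf hmods h15 L hZ hcharY hlim).toRecord
    (h1LimConjMulAut (phi C) (D.lDeltaTheta l) (PiYdd C)) κ
    (fun ι : inversionOrbit C ρ => (ι : h1Lim (phi C) (D.lDeltaTheta l) (PiYdd C) ⊥ ≃+ h1Lim (phi C) (D.lDeltaTheta l) (PiYdd C) ⊥))

include hcharY in
/-- **J2 for the orbit-indexed record**: the conjugation action PERMUTES `{θ^ι_env}_ι`, `{∞θ^ι_env}_ι`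
(abc-iut-w5-d169's `ThetaEnvPermuted`), UNCONDITIONALLY — by abc-iut-w4-d030's `thetaEnvPermuted_record` with the
orbit's stability under conjugation. [cite: Mochizuki2012, Prop 3.1 (i) p.87] -/
theorem thetaEnvPermuted_thetaEnvRecordOrbit {M : Type} [CommMonoid M]
    (κ : M →* Multiplicative (thetaEnvData C hC hS hl hp2 hpl hζ mods f hf hmods h15 L hZ hcharY hlim).cohEnv.lim)
    (ρ : h1Lim (phi C) (D.lDeltaTheta l) (PiYdd C) ⊥ ≃+ h1Lim (phi C) (D.lDeltaTheta l) (PiYdd C) ⊥) :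
    (thetaEnvRecordOrbit C hC hS hl hp2 hpl hζ mods f hf hmods h15 L hZ hcharY hlim κ ρ).ThetaEnvPermuted :=
  thetaEnvPermuted_record C hC hS hl hp2 hpl hζ mods f hf hmods h15 L hZ hcharY hlim κ _ fun g ι =>
    ⟨⟨_, conj_mem_inversionOrbit C ρ g ι.2⟩, fun x => by
      change h1LimConj (phi C) (D.lDeltaTheta l) (PiYdd C) g
          (ι.1 (h1LimConj (phi C) (D.lDeltaTheta l) (PiYdd C) g⁻¹
            (h1LimConj (phi C) (D.lDeltaTheta l) (PiYdd C) g x))) =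
        h1LimConj (phi C) (D.lDeltaTheta l) (PiYdd C) g (ι.1 x)
      rw [← h1LimConj_mul_apply, inv_mul_cancel, h1LimConj_one_apply]⟩

/-! ### 2. INPUT (P1): homomorphic companions of the automorphisms of `Π^tp_{X̲̲}` on `(Π^tp_X)^Θ` -/

/-- **INPUT (P1) — companion automorphisms** (DATA package): for every topological automorphism `α` of
`Π^tp_{X̲̲}` a topological automorphism `β(α)` of `(Π^tp_X)^Θ` compatible with `φ : Π^tp_{X̲̲} → (Π^tp_X)^Θ` and mapping
`l·Δ_Θ` onto itself, HOMOMORPHICALLY in `α` ([EtTh] Cor 2.18 (i) class: the relevant subquotients are characteristic;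
the genuine choice is the induced automorphism of the characteristic quotient).
[cite: MochizukiEtTh2009, Cor 2.18 (i) p.60] -/
structure AutCompanion : Type where
  /-- the companion `β(α)` on `(Π^tp_X)^Θ` -/
  beta : ((Pi C) ≃ₜ* (Pi C)) → (D.GtpTheta ≃ₜ* D.GtpTheta)
  /-- compatibility with `φ` -/
  compat : ∀ (α : (Pi C) ≃ₜ* (Pi C)) (g : Pi C), beta α (phi C g) = phi C (α g)
  /-- `β(α)` maps `l·Δ_Θ` onto itself -/
  memA : ∀ (α : (Pi C) ≃ₜ* (Pi C)) (a : D.GtpTheta), a ∈ D.lDeltaTheta l ↔ beta α a ∈ D.lDeltaTheta l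
  /-- the identity's companion is the identity -/
  beta_refl : beta (ContinuousMulEquiv.refl _) = ContinuousMulEquiv.refl _
  /-- composites' companions are composites -/
  beta_trans : ∀ α₁ α₂ : (Pi C) ≃ₜ* (Pi C), beta (α₁.trans α₂) = (beta α₁).trans (beta α₂)

variable {C}

/-- **The action of `α ∈ Aut(Π^tp_{X̲̲})` on `lim_J H¹(Π^tp_{Ÿ̲̲} ∩ J, l·Δ_Θ)`** through its companion: abc-iut-w5-d072's
`pairRhoLim` (= abc-iut-L6-t1's `h1LimAutEquiv`) of the pair `(α, β(α))`; `Π^tp_{Ÿ̲̲}` is `α`-stable by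
`PiYddCharacteristic`. [cite: Mochizuki2012, Cor 1.12 (i) p.57] -/
def pairAct (B : AutCompanion C) (hchar : PiYddCharacteristic C) (α : (Pi C) ≃ₜ* (Pi C)) :
    h1Lim (phi C) (D.lDeltaTheta l) (PiYdd C) ⊥ ≃+ h1Lim (phi C) (D.lDeltaTheta l) (PiYdd C) ⊥ :=
  pairRhoLim C α (B.beta α) (B.compat α) (B.memA α) (mem_PiYdd_iff_of_piYddCharacteristic C hchar α)

omit [(EtaleThetaDataOfSetting.PiYdd C).Normal] in
/-- `pairAct` depends on `α` only (congruence for rewriting the automorphism). [cite: Mochizuki2012, Cor 1.12 (i) p.57] -/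
theorem pairAct_congr (B : AutCompanion C) (hchar : PiYddCharacteristic C) {α α' : (Pi C) ≃ₜ* (Pi C)}
    (h : α = α') (x : h1Lim (phi C) (D.lDeltaTheta l) (PiYdd C) ⊥) : pairAct B hchar α x = pairAct B hchar α' x := by
  subst h; rfl

omit [(EtaleThetaDataOfSetting.PiYdd C).Normal] in
/-- **Identity law**: the identity of `Π^tp_{X̲̲}` acts as the identity. [cite: Mochizuki2012, Cor 1.12 (i) p.57] -/
theorem pairAct_refl (B : AutCompanion C) (hchar : PiYddCharacteristic C) (x : h1Lim (phi C) (D.lDeltaTheta l) (PiYdd C) ⊥) :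
    pairAct B hchar (ContinuousMulEquiv.refl _) x = x :=
  (h1LimAutEquiv_congr (phi C) (D.lDeltaTheta l) (PiYdd C) rfl B.beta_refl (B.compat _) (B.memA _)
      (mem_PiYdd_iff_of_piYddCharacteristic C hchar _)
      (ContH1Aut.compat_refl (phi C)) (fun _ => Iff.rfl) (stab_refl (PiYdd C)) x).trans
    (h1LimAutEquiv_refl_apply (phi C) (D.lDeltaTheta l) (PiYdd C) x)

omit [(EtaleThetaDataOfSetting.PiYdd C).Normal] in
/-- **Composition law**: `α₁ ≫ α₂` acts as the composite. [cite: Mochizuki2012, Cor 1.12 (i) p.57] -/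
theorem pairAct_trans (B : AutCompanion C) (hchar : PiYddCharacteristic C) (α₁ α₂ : (Pi C) ≃ₜ* (Pi C))
    (x : h1Lim (phi C) (D.lDeltaTheta l) (PiYdd C) ⊥) :
    pairAct B hchar (α₁.trans α₂) x = pairAct B hchar α₂ (pairAct B hchar α₁ x) := by
  refine Eq.trans ?_ (h1LimAutEquiv_trans_apply (phi C) (D.lDeltaTheta l) (PiYdd C) (B.compat α₁) (B.compat α₂)
    (B.memA α₁) (B.memA α₂) (mem_PiYdd_iff_of_piYddCharacteristic C hchar α₁)
    (mem_PiYdd_iff_of_piYddCharacteristic C hchar α₂) x).symm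
  exact h1LimAutEquiv_congr (phi C) (D.lDeltaTheta l) (PiYdd C) rfl (B.beta_trans α₁ α₂) (B.compat _)
    (B.memA _) (mem_PiYdd_iff_of_piYddCharacteristic C hchar _) _ _ _ x

omit [(EtaleThetaDataOfSetting.PiYdd C).Normal] in
/-- The inverse automorphism acts as the inverse. [cite: Mochizuki2012, Cor 1.12 (i) p.57] -/
theorem pairAct_symm (B : AutCompanion C) (hchar : PiYddCharacteristic C) (α : (Pi C) ≃ₜ* (Pi C))
    (x : h1Lim (phi C) (D.lDeltaTheta l) (PiYdd C) ⊥) : pairAct B hchar α.symm x = (pairAct B hchar α).symm x := by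
  apply (pairAct B hchar α).injective
  rw [AddEquiv.apply_symm_apply, ← pairAct_trans,
    pairAct_congr B hchar (show α.symm.trans α = ContinuousMulEquiv.refl _ from
      ContinuousMulEquiv.ext fun y => α.apply_symm_apply y), pairAct_refl]

omit [(EtaleThetaDataOfSetting.PiYdd C).Normal] in
/-- … and the inverse of the action of `α⁻¹` is the action of `α`. [cite: Mochizuki2012, Cor 1.12 (i) p.57] -/
theorem pairAct_symm_symm (B : AutCompanion C) (hchar : PiYddCharacteristic C) (α : (Pi C) ≃ₜ* (Pi C))
    (x : h1Lim (phi C) (D.lDeltaTheta l) (PiYdd C) ⊥) : (pairAct B hchar α.symm).symm x = pairAct B hchar α x := by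
  apply (pairAct B hchar α.symm).injective
  rw [AddEquiv.apply_symm_apply, pairAct_symm, AddEquiv.symm_apply_apply]

/-- **The pair action intertwines conjugation**: `ρ_α ∘ conj_h = conj_{α h} ∘ ρ_α` (`CohomologyAutConjCompat`).
[cite: Mochizuki2012, Prop 3.4 (i) p.91] -/
theorem pairAct_conj (B : AutCompanion C) (hchar : PiYddCharacteristic C) (α : (Pi C) ≃ₜ* (Pi C)) (h : Pi C)
    (x : h1Lim (phi C) (D.lDeltaTheta l) (PiYdd C) ⊥) :
    pairAct B hchar α (h1LimConj (phi C) (D.lDeltaTheta l) (PiYdd C) h x) = h1LimConj (phi C) (D.lDeltaTheta l) (PiYdd C) (α h) (pairAct B hchar α x) := by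
  have key := h1LimAutEquiv_h1LimConjEquiv (phi C) (D.lDeltaTheta l) (PiYdd C) α (B.beta α) (B.compat α)
    (mem_PiYdd_iff_of_piYddCharacteristic C hchar α) (B.memA α) h x
  rw [h1LimConjEquiv_apply, h1LimConjEquiv_apply] at key
  exact key

/-! ### 3. The orbit is permuted by CONJUGATION with the pair action (INPUT (P2)) -/

section Orbit

variable (B : AutCompanion C) (hchar : PiYddCharacteristic C) (ρ : h1Lim (phi C) (D.lDeltaTheta l) (PiYdd C) ⊥ ≃+ h1Lim (phi C) (D.lDeltaTheta l) (PiYdd C) ⊥)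
  (hρ : ∀ α : (Pi C) ≃ₜ* (Pi C), ∃ c : Pi C, ∀ x,
    pairAct B hchar α (ρ x) = h1LimConj (phi C) (D.lDeltaTheta l) (PiYdd C) c (ρ (h1LimConj (phi C) (D.lDeltaTheta l) (PiYdd C) c⁻¹ (pairAct B hchar α x))))

include hρ in
/-- Conjugating an orbit element by the action of `α` stays in the orbit (uses (P2) and the equivariance
`pairAct_conj`). [cite: Mochizuki2012, Prop 2.2 (i) p.66] -/
theorem conjAct_mem_inversionOrbit (α : (Pi C) ≃ₜ* (Pi C)) {e : h1Lim (phi C) (D.lDeltaTheta l) (PiYdd C) ⊥ ≃+ h1Lim (phi C) (D.lDeltaTheta l) (PiYdd C) ⊥}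
    (he : e ∈ inversionOrbit C ρ) :
    ((pairAct B hchar α).symm.trans (e.trans (pairAct B hchar α))) ∈ inversionOrbit C ρ := by
  obtain ⟨h, hh⟩ := he
  obtain ⟨c, hc⟩ := hρ α
  refine ⟨α h * c, fun x => ?_⟩
  rw [AddEquiv.trans_apply, AddEquiv.trans_apply, hh, pairAct_conj, hc, pairAct_conj, map_inv,
    AddEquiv.apply_symm_apply, ← h1LimConj_mul_apply, ← h1LimConj_mul_apply, mul_inv_rev]

include hρ in
/-- … and conjugating the other way (by the action of `α⁻¹`, `pairAct_symm`). [cite: Mochizuki2012, Prop 2.2 (i) p.66] -/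
theorem conjActSymm_mem_inversionOrbit (α : (Pi C) ≃ₜ* (Pi C)) {e : h1Lim (phi C) (D.lDeltaTheta l) (PiYdd C) ⊥ ≃+ h1Lim (phi C) (D.lDeltaTheta l) (PiYdd C) ⊥}
    (he : e ∈ inversionOrbit C ρ) :
    ((pairAct B hchar α).trans (e.trans (pairAct B hchar α).symm)) ∈ inversionOrbit C ρ := by
  obtain ⟨h', hh'⟩ := conjAct_mem_inversionOrbit B hchar ρ hρ α.symm he
  refine ⟨h', fun x => ?_⟩
  rw [← hh' x, AddEquiv.trans_apply, AddEquiv.trans_apply, AddEquiv.trans_apply, AddEquiv.trans_apply,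
    pairAct_symm, pairAct_symm_symm]

/-- **The index matching induced by `α`**: conjugation of the orbit by the pair action, a bijection of the orbit
(inverse: conjugation by the action of `α⁻¹`). [cite: Mochizuki2012, Prop 3.4 (i) p.91] -/
def orbitEquiv (α : (Pi C) ≃ₜ* (Pi C)) : inversionOrbit C ρ ≃ inversionOrbit C ρ where
  toFun ι := ⟨(pairAct B hchar α).symm.trans (ι.1.trans (pairAct B hchar α)),
    conjAct_mem_inversionOrbit B hchar ρ hρ α ι.2⟩
  invFun ι := ⟨(pairAct B hchar α).trans (ι.1.trans (pairAct B hchar α).symm),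
    conjActSymm_mem_inversionOrbit B hchar ρ hρ α ι.2⟩
  left_inv ι := Subtype.ext (AddEquiv.ext fun x => by simp)
  right_inv ι := Subtype.ext (AddEquiv.ext fun x => by simp)

/-- The matched inversion intertwines the action: `ι'(ρ_α x) = ρ_α (ι x)`. [cite: Mochizuki2012, Prop 3.4 (i) p.91] -/
theorem orbitEquiv_apply_apply (α : (Pi C) ≃ₜ* (Pi C)) (ι : inversionOrbit C ρ) (x : h1Lim (phi C) (D.lDeltaTheta l) (PiYdd C) ⊥) :
    (orbitEquiv B hchar ρ hρ α ι).1 (pairAct B hchar α x) = pairAct B hchar α (ι.1 x) := by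
  change pairAct B hchar α (ι.1 ((pairAct B hchar α).symm (pairAct B hchar α x))) = _
  rw [AddEquiv.symm_apply_apply]

end Orbit

/-! ### 4. The `AutIsoAction` on the genuine record (J10, genuine form) -/

section Action

variable {M : Type} [CommMonoid M]
  (κ : M →* Multiplicative (thetaEnvData C hC hS hl hp2 hpl hζ mods f hf hmods h15 L hZ hcharY hlim).cohEnv.lim)
  (B : AutCompanion C) (ρ : h1Lim (phi C) (D.lDeltaTheta l) (PiYdd C) ⊥ ≃+ h1Lim (phi C) (D.lDeltaTheta l) (PiYdd C) ⊥)
  (hρ : ∀ α : (Pi C) ≃ₜ* (Pi C), ∃ c : Pi C, ∀ x,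
    pairAct B hcharY α (ρ x) = h1LimConj (phi C) (D.lDeltaTheta l) (PiYdd C) c (ρ (h1LimConj (phi C) (D.lDeltaTheta l) (PiYdd C) c⁻¹ (pairAct B hcharY α x))))
  (hκ : ∀ α : (Pi C) ≃ₜ* (Pi C),
    (MonoidHom.mrange κ).map (AddEquiv.toMultiplicative (pairAct B hcharY α) :
      Multiplicative (h1Lim (phi C) (D.lDeltaTheta l) (PiYdd C) ⊥) →*
        Multiplicative (h1Lim (phi C) (D.lDeltaTheta l) (PiYdd C) ⊥)) = MonoidHom.mrange κ)
  (hθ : ∀ α : (Pi C) ≃ₜ* (Pi C), pairAct B hcharY α ''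
    ((thetaEnvData C hC hS hl hp2 hpl hζ mods f hf hmods h15 L hZ hcharY hlim).D.coh.toLim ⊤ ''
      (thetaEnvData C hC hS hl hp2 hpl hζ mods f hf hmods h15 L hZ hcharY hlim).D.theta) =
    (thetaEnvData C hC hS hl hp2 hpl hζ mods f hf hmods h15 L hZ hcharY hlim).D.coh.toLim ⊤ ''
      (thetaEnvData C hC hS hl hp2 hpl hζ mods f hf hmods h15 L hZ hcharY hlim).D.theta)
  (hinf : ∀ α : (Pi C) ≃ₜ* (Pi C), pairAct B hcharY α ''
    (thetaEnvData C hC hS hl hp2 hpl hζ mods f hf hmods h15 L hZ hcharY hlim).D.thetaInfty =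
    (thetaEnvData C hC hS hl hp2 hpl hζ mods f hf hmods h15 L hZ hcharY hlim).D.thetaInfty)

include hθ hinf in
/-- **The isomorphism of the genuine record ALONG `α`** ("compatible collections of isomorphisms", Prop 3.4 (i)
p. 91): module component = the pair action of `(α, β(α))`; index component = conjugation of the inversion orbit;
compatibility with the conjugation actions = `h1LimAut_h1LimConj`; `M_TM = κ(𝒪^▷)` and `M^×_TM` carried onto
themselves by (P3); `θ^ι_env ↦ θ^{ι'}_env`, `∞θ^ι_env ↦ ∞θ^{ι'}_env` by (P4) and abc-iut-w4-d019's bridge lemmas.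
[cite: Mochizuki2012, Prop 3.4 (i) p.91] -/
def recordIsoOf (α : (Pi C) ≃ₜ* (Pi C)) :
    TemperedThetaMonoids.ThetaEnvData.Iso
      (thetaEnvRecordOrbit C hC hS hl hp2 hpl hζ mods f hf hmods h15 L hZ hcharY hlim κ ρ)
      (thetaEnvRecordOrbit C hC hS hl hp2 hpl hζ mods f hf hmods h15 L hZ hcharY hlim κ ρ) where
  phi := α.toMulEquiv
  e := AddEquiv.toMultiplicative (pairAct B hcharY α)
  iota := orbitEquiv B hcharY ρ hρ α
  map_conj g x := by
    change Multiplicative.ofAdd (pairAct B hcharY α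
        (h1LimConj (phi C) (D.lDeltaTheta l) (PiYdd C) g (Multiplicative.toAdd x))) =
      Multiplicative.ofAdd (h1LimConj (phi C) (D.lDeltaTheta l) (PiYdd C) (α g)
        (pairAct B hcharY α (Multiplicative.toAdd x)))
    rw [pairAct_conj]
  map_units := unitsOfSubmonoid_map_eq _ _ (hκ α)
  map_constants := hκ α
  image_thetaEnv ι := by
    change AddEquiv.toMultiplicative (pairAct B hcharY α) ''
        (thetaEnvData C hC hS hl hp2 hpl hζ mods f hf hmods h15 L hZ hcharY hlim).envSet
          ((thetaEnvData C hC hS hl hp2 hpl hζ mods f hf hmods h15 L hZ hcharY hlim).thetaIotaLim ι.1) =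
      (thetaEnvData C hC hS hl hp2 hpl hζ mods f hf hmods h15 L hZ hcharY hlim).envSet
        ((thetaEnvData C hC hS hl hp2 hpl hζ mods f hf hmods h15 L hZ hcharY hlim).thetaIotaLim
          (orbitEquiv B hcharY ρ hρ α ι).1)
    refine (ThetaEnvData.image_envSet_of_compat (thetaEnvData C hC hS hl hp2 hpl hζ mods f hf hmods h15 L hZ hcharY hlim) (AddEquiv.toMultiplicative (pairAct B hcharY α))
      (pairAct B hcharY α) (fun x => rfl) _).trans ?_
    exact congrArg (thetaEnvData C hC hS hl hp2 hpl hζ mods f hf hmods h15 L hZ hcharY hlim).envSet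
      (ThetaEnvData.image_iotaInvariants_of_conj (thetaEnvData C hC hS hl hp2 hpl hζ mods f hf hmods h15 L hZ hcharY hlim) (pairAct B hcharY α) ι.1
        (orbitEquiv B hcharY ρ hρ α ι).1 (orbitEquiv_apply_apply B hcharY ρ hρ α ι) (hθ α))
  image_inftyThetaEnv ι := by
    change AddEquiv.toMultiplicative (pairAct B hcharY α) ''
        (thetaEnvData C hC hS hl hp2 hpl hζ mods f hf hmods h15 L hZ hcharY hlim).envSet
          ((thetaEnvData C hC hS hl hp2 hpl hζ mods f hf hmods h15 L hZ hcharY hlim).thetaInftyIotaLim ι.1) =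
      (thetaEnvData C hC hS hl hp2 hpl hζ mods f hf hmods h15 L hZ hcharY hlim).envSet
        ((thetaEnvData C hC hS hl hp2 hpl hζ mods f hf hmods h15 L hZ hcharY hlim).thetaInftyIotaLim
          (orbitEquiv B hcharY ρ hρ α ι).1)
    refine (ThetaEnvData.image_envSet_of_compat (thetaEnvData C hC hS hl hp2 hpl hζ mods f hf hmods h15 L hZ hcharY hlim) (AddEquiv.toMultiplicative (pairAct B hcharY α))
      (pairAct B hcharY α) (fun x => rfl) _).trans ?_
    exact congrArg (thetaEnvData C hC hS hl hp2 hpl hζ mods f hf hmods h15 L hZ hcharY hlim).envSet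
      (ThetaEnvData.image_iotaInvariants_of_conj (thetaEnvData C hC hS hl hp2 hpl hζ mods f hf hmods h15 L hZ hcharY hlim) (pairAct B hcharY α) ι.1
        (orbitEquiv B hcharY ρ hρ α ι).1 (orbitEquiv_apply_apply B hcharY ρ hρ α ι) (hinf α))

/-- **J10 at the genuine data — the `Aut(Π^tp_{X̲̲_k})`-action on the Prop 3.1 record by isomorphisms**
(`TemperedThetaMonoids.ThetaEnvData.AutIsoAction`), FUNCTORIAL: identity ↦ identity and composite ↦ composite on
the module (`pairAct_refl/_trans`, i.e. `h1LimAut_refl/_trans`) and on the inversion orbit (conjugation by a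
homomorphic action). [cite: Mochizuki2012, Prop 3.4 (i) p.91] -/
def autIsoActionOrbit :
    TemperedThetaMonoids.ThetaEnvData.AutIsoAction
      (thetaEnvRecordOrbit C hC hS hl hp2 hpl hζ mods f hf hmods h15 L hZ hcharY hlim κ ρ) where
  iso α := recordIsoOf hC hS hl hp2 hpl hζ mods f hf hmods h15 L hZ hcharY hlim κ B ρ hρ hκ hθ hinf α
  iso_phi _ _ := rfl
  iso_refl_e x := congrArg Multiplicative.ofAdd (pairAct_refl B hcharY (Multiplicative.toAdd x))
  iso_refl_iota ι := Subtype.ext (AddEquiv.ext fun x => by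
    change pairAct B hcharY (ContinuousMulEquiv.refl _)
        (ι.1 ((pairAct B hcharY (ContinuousMulEquiv.refl _)).symm x)) = ι.1 x
    rw [pairAct_refl]
    congr 1
    apply (pairAct B hcharY (ContinuousMulEquiv.refl _)).injective
    rw [AddEquiv.apply_symm_apply, pairAct_refl])
  iso_trans_e α₁ α₂ x := congrArg Multiplicative.ofAdd (pairAct_trans B hcharY α₁ α₂ (Multiplicative.toAdd x))
  iso_trans_iota α₁ α₂ ι := Subtype.ext (AddEquiv.ext fun x => by
    change pairAct B hcharY (α₁.trans α₂) (ι.1 ((pairAct B hcharY (α₁.trans α₂)).symm x)) =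
      pairAct B hcharY α₂ (pairAct B hcharY α₁
        (ι.1 ((pairAct B hcharY α₁).symm ((pairAct B hcharY α₂).symm x))))
    erw [pairAct_trans]
    congr 3
    apply (pairAct B hcharY (α₁.trans α₂)).injective
    erw [AddEquiv.apply_symm_apply, pairAct_trans, AddEquiv.apply_symm_apply, AddEquiv.apply_symm_apply])

/-- **The transport input of Prop 3.4 (i) at the genuine data**: theta-environment data on EVERY isomorph of
`Π^tp_{X̲̲}` functorially in isomorphisms of topological groups (`ThetaEnvTransport.ofAutAction` of the action
above), over abc-iut-L6-d6's [IUTchII] §1 setting `ThetaSetting.ofDoubleUnderline` of the Tate curve (whose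
`Π^tp_{X̲̲_k}` IS `Pi C`). [cite: Mochizuki2012, Prop 3.4 (i) p.91] -/
def thetaEnvTransportGenuine {N : ℕ+} (μ : D.CyclotomeMod l N)
    {η : (C.thetaEnvData μ hC hS).PiYdd → MuN p N} (hη : η ∈ (C.thetaEnvData μ hC hS).thetaCocycles) :
    TemperedThetaMonoids.ThetaEnvTransport (ThetaSetting.ofDoubleUnderline C μ hC hS hl hp2 hpl hζ hη) :=
  TemperedThetaMonoids.ThetaEnvTransport.ofAutAction
    (S := ThetaSetting.ofDoubleUnderline C μ hC hS hl hp2 hpl hζ hη)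
    (thetaEnvRecordOrbit C hC hS hl hp2 hpl hζ mods f hf hmods h15 L hZ hcharY hlim κ ρ)
    (autIsoActionOrbit hC hS hl hp2 hpl hζ mods f hf hmods h15 L hZ hcharY hlim κ B ρ hρ hκ hθ hinf)

/-- **[IUTchII] Prop 3.4 (i) — MULTIRADIALITY OF SPLIT THETA MONOIDS AT THE GENUINE FUNCTOR** (junctions J10 + J12
of the sub-DAG): the functor `Π_v ↦ (Π_v ↷ {Ψ^ι_env(𝕄_*(Π_v))}_ι, M^×_TM, Ψ_cns)` built from the NATURAL system of
mono-theta environments of `X̲̲_K` (transport of the genuine record along isomorphisms `Π_v ⥲ Π^tp_{X̲̲}` and the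
`Aut(Π^tp_{X̲̲})`-action above) on the radial category of Example 1.8 (iii)/(iv) IS multiradially defined — modulo
exactly the binders (P1) `B`, (P2) `hρ`, (P3) `hκ`, (P4) `hθ`/`hinf` (abc-iut-w5-d169's `prop34i_multiradiallyDefined`,
itself abc-iut-L6-t1's `cor111_multiradiallyDefined`). [cite: Mochizuki2012, Prop 3.4 (i) p.92] -/
theorem prop34i_multiradiallyDefined_genuine {N : ℕ+} (μ : D.CyclotomeMod l N)
    {η : (C.thetaEnvData μ hC hS).PiYdd → MuN p N} (hη : η ∈ (C.thetaEnvData μ hC hS).thetaCocycles)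
    (Γ : Type) [Group Γ] :
    ((ex18iii (ThetaSetting.ofDoubleUnderline C μ hC hS hl hp2 hpl hζ hη) Γ).toDagger
      (TemperedThetaMonoids.prop34iRadialFunctor
        (thetaEnvTransportGenuine hC hS hl hp2 hpl hζ mods f hf hmods h15 L hZ hcharY hlim κ B ρ hρ hκ hθ hinf μ hη)
        Γ)).IsMultiradiallyDefined :=
  TemperedThetaMonoids.prop34i_multiradiallyDefined _ Γ

end Action

end EtaleLevels

end Literature.IUT.HodgeArakelov

end
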